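import Mathlib
import HarnessLib
import Literature.Probability.MarkovChains.MetropolisHastings
import Summits.Ventures.LatticeQCDFlow.Exactness.JarzynskiFinite
import Summits.Ventures.LatticeQCDFlow.Exactness.FlowMCMC
import Summits.Ventures.LatticeQCDFlow.Scaling.ImportanceWeights
import Summits.Ventures.LatticeQCDFlow.Scaling.StochasticFlows
import Summits.Ventures.LatticeQCDFlow.Scaling.PerfectRelaxationCounterexample

/-!
# A flow-MCMC layer with a GENERIC model law can beat perfect relaxation: a four-state, two-layer
# witness (pub-lqcd THEORY-2 v2.5, §3.5 (iv) / §4 row C3)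

HONEST FRAMING: exact (Metropolis-corrected) sampling algorithms for lattice gauge theory; figures
of merit are autocorrelation/cost numbers at stated couplings and volumes; no continuum-physics
claim.

Companion to `PerfectRelaxationIMH` (item 25): there, flow-MCMC (independence Metropolis) layers
whose model laws lie in the target's one-parameter family `e^{−γA}` are stochastically monotone and
hence DOMINATED by perfect relaxation (`ÊSS ≤ Π_k ESS(p_{k+1}, p_k)`).  Here: the hypothesis is
needed.  For a model law `q` OUTSIDE the family the flow-MCMC layer can be non-monotone along the
action and the path ESS can EXCEED the perfect-relaxation product — the super-relaxation effect of
the (C3′) counterexample (`Conjectures.not_perfectRelaxationDominates`, row 30), realised by an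
honest flow-MCMC kernel `Exactness.imhKernel`.

THE WITNESS (exact rationals).  `X = Fin 4`, `e^{−A} = t = (11/16, 5/8, 1/4, 5/16)`, `β = (1, 2, 4)`
(monotone; Gibbs weights `t^β`: `p₀ = (11,10,4,5)/30`, `p₁ = (121,100,16,25)/262`,
`p₂ = (14641,10000,256,625)/25522`); layer 0 = `imhKernel e^{−β₁A} q` with the model law
`q = (23, 1, 3, 5)/32` (rows `(2813/3872, 1/32, 3/32, 575/3872)`,
`(121/3200, 1519/1600, 1/200, 1/128)`, `(363/512, 1/32, 29/256, 75/512)`,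
`(23/32, 1/32, 3/32, 5/32)`); layer 1 = the perfectly trained flow `imhKernel e^{−β₂A} p₂` = perfect
relaxation onto `p₂`.  Then `ESS(path) = 2605489936/3221286525 = 0.808835… > Π ESS =
(17161/18900)·(162843121/182828971) = 3047492693/3768230700 = 0.808733…` (ratio `1.000126`;
`theorem flowMCMC_layer_can_beat_perfectRelaxation`).
Found by the float scan `lean/theory2/check/imh_monotonicity_scan.py` (generic Dirichlet model laws:
non-monotone in 42 % of draws, ratio up to `1.0048`) and rationalised in
`check/imh_generic_proposal_witness.py`.  Elementary; nothing cited as a fact. [folklore]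
-/

noncomputable section

namespace Summit.Ventures.LatticeQCDFlow.Theory2

open Finset Summit.Ventures.LatticeQCDFlow Summit.Ventures.LatticeQCDFlow.Exactness
open Literature.Probability.MarkovChains
-- the protocol `β = (1, 2, 4)` and its monotonicity are REUSED from row 30's (C3′) witness
open Summit.Ventures.LatticeQCDFlow.Conjectures.C3Witness (b β monotone_β)

namespace IMHWitness

/-- Boltzmann factors `t = e^{−A} = (11/16, 5/8, 1/4, 5/16)`. [folklore] -/
def t : Fin 4 → ℝ := ![11 / 16, 5 / 8, 1 / 4, 5 / 16]

/-- The action `A = −log t`, so that `e^{−βA} = t^β` is rational for the integer protocol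
`β = C3Witness.β = (1, 2, 4)` of row 30's witness (reused, with `C3Witness.monotone_β`).
[folklore] -/
def A (x : Fin 4) : ℝ := -Real.log (t x)

/-- The generic model law of layer 0, `q = (23, 1, 3, 5)/32` (not of the form `e^{−γA}/Z`).
[folklore] -/
def q : Fin 4 → ℝ := ![23 / 32, 1 / 32, 3 / 32, 5 / 32]

/-- The two layers as explicit rational matrices: layer 0 = `imhKernel e^{−β₁A} q`
(`P_zero_eq_imhKernel`), layer 1 = perfect relaxation onto `p₂` = the perfectly trained flow
`imhKernel e^{−β₂A} p₂` (`P_one_eq_imhKernel`). [folklore] -/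
def P : Fin 2 → Fin 4 → Fin 4 → ℝ :=
  ![![![2813 / 3872, 1 / 32, 3 / 32, 575 / 3872],
      ![121 / 3200, 1519 / 1600, 1 / 200, 1 / 128],
      ![363 / 512, 1 / 32, 29 / 256, 75 / 512],
      ![23 / 32, 1 / 32, 3 / 32, 5 / 32]],
    ![![14641 / 25522, 10000 / 25522, 256 / 25522, 625 / 25522],
      ![14641 / 25522, 10000 / 25522, 256 / 25522, 625 / 25522],
      ![14641 / 25522, 10000 / 25522, 256 / 25522, 625 / 25522],
      ![14641 / 25522, 10000 / 25522, 256 / 25522, 625 / 25522]]]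

/-- The Boltzmann factors are positive. [folklore] -/
theorem t_pos (x : Fin 4) : 0 < t x := by
  fin_cases x <;> simp [t]

/-- The Gibbs weights are the rational powers `e^{−β_k A(x)} = t(x)^{b_k}`. [folklore] -/
theorem exp_βA (k : Fin 3) (x : Fin 4) : Real.exp (-(β k * A x)) = t x ^ b k := by
  simp only [β, A]
  rw [show -((b k : ℝ) * -Real.log (t x)) = (b k : ℝ) * Real.log (t x) by ring, Real.exp_nat_mul,
    Real.exp_log (t_pos x)]

/-- Sums over paths of length three are triple sums. [folklore] -/
theorem sum_path_three (F : (Fin (2 + 1) → Fin 4) → ℝ) :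
    ∑ ω : Fin (2 + 1) → Fin 4, F ω = ∑ x₀ : Fin 4, ∑ x₁ : Fin 4, ∑ x₂ : Fin 4, F ![x₀, x₁, x₂] := by
  rw [Exactness.sum_path_cons]
  refine Finset.sum_congr rfl fun x₀ _ => ?_
  rw [Exactness.sum_path_cons]
  refine Finset.sum_congr rfl fun x₁ _ => ?_
  rw [Exactness.sum_path_zero]
  refine Finset.sum_congr rfl fun x₂ _ => ?_
  congr 1
  funext i
  fin_cases i <;> rfl

/-- The model law is positive. [folklore] -/
theorem q_pos (x : Fin 4) : 0 < q x := by
  fin_cases x <;> simp [q]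

/-- The model law is normalised. [folklore] -/
theorem sum_q : ∑ x, q x = 1 := by
  simp [q, Fin.sum_univ_four]
  norm_num

/-- Layer 0 IS the flow-MCMC kernel with target `e^{−β₁A}` and model law `q`. [folklore] -/
theorem P_zero_eq_imhKernel : P 0 = imhKernel (fun x => Real.exp (-(β 1 * A x))) q := by
  funext x y
  simp only [imhKernel, mhKernel, mhRate, exp_βA, Finset.sum_erase_eq_sub (Finset.mem_univ _),
    Fin.sum_univ_four]
  fin_cases x <;> fin_cases y <;> simp [P, q, t, b] <;> norm_num [min_def]

/-- Layer 1 IS the flow-MCMC kernel with target `e^{−β₂A}` and the perfectly trained model law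
`p₂` (= perfect relaxation onto `p₂`). [folklore] -/
theorem P_one_eq_imhKernel :
    P 1 = imhKernel (fun x => Real.exp (-(β 2 * A x))) (gibbsLaw fun x => β 2 * A x) := by
  funext x y
  simp only [imhKernel, mhKernel, mhRate, gibbsLaw, partitionFn, exp_βA,
    Finset.sum_erase_eq_sub (Finset.mem_univ _), Fin.sum_univ_four]
  fin_cases x <;> fin_cases y <;> simp [P, t, b] <;> norm_num [min_def]

/-- The perfect-relaxation value `Π_k ESS(p_{k+1}, p_k) = (17161/18900)·(162843121/182828971)
= 3047492693/3768230700`. [folklore] -/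
theorem rhs_eq :
    ∏ k : Fin 2, essFrac (gibbsLaw fun x => β k.succ * A x)
        (gibbsLaw fun x => β k.castSucc * A x) = 3047492693 / 3768230700 := by
  simp only [essFrac, weight, gibbsLaw, partitionFn, exp_βA, Fin.sum_univ_four, Fin.prod_univ_two]
  simp [t, b]
  norm_num

set_option maxHeartbeats 4000000 in
/-- The path ESS of the witness: `ESS(revPathLaw, pathLaw) = 2605489936/3221286525`. [folklore] -/
theorem lhs_eq :
    essFrac (revPathLaw (fun k x => β k * A x) P) (pathLaw (gibbsLaw fun x => β 0 * A x) P) =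
      2605489936 / 3221286525 := by
  rw [essFrac, sum_path_three, sum_path_three]
  simp only [weight, revPathLaw, revKernel, pathLaw, transProb, gibbsLaw, partitionFn, exp_βA,
    Fin.sum_univ_four, Fin.prod_univ_two]
  simp [P, t, b, show (Fin.last 2 : Fin 3) = 2 from rfl]
  norm_num

end IMHWitness

open IMHWitness in
/-- **A flow-MCMC layer with a generic model law can beat perfect relaxation** (OURS).  There is a
monotone exponential-family protocol on four states whose two layers are honest flow-MCMC
(independence Metropolis–Hastings) kernels — layer 0 with a model law OUTSIDE the family
`e^{−γA}`, layer 1 a perfectly trained flow — and whose path ESS is STRICTLY LARGER than the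
perfect-relaxation product `Π_k ESS(p_{k+1}, p_k)`.  So the weight-monotonicity hypothesis of
`perfectRelaxation_dominates_imh_expFamily` / (C3″) cannot be dropped for flow-MCMC layers: IMH
structure (reversible, positive-semidefinite) alone does not give dominance. [folklore] -/
theorem flowMCMC_layer_can_beat_perfectRelaxation :
    ∃ (A : Fin 4 → ℝ) (β : Fin 3 → ℝ) (q : Fin 4 → ℝ) (P : Fin 2 → Fin 4 → Fin 4 → ℝ),
      Monotone β ∧ (∀ x, 0 < q x) ∧ ∑ x, q x = 1 ∧
      P 0 = imhKernel (fun x => Real.exp (-(β 1 * A x))) q ∧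
      P 1 = imhKernel (fun x => Real.exp (-(β 2 * A x))) (gibbsLaw fun x => β 2 * A x) ∧
      ∏ k : Fin 2, essFrac (gibbsLaw fun x => β k.succ * A x)
          (gibbsLaw fun x => β k.castSucc * A x) <
        essFrac (revPathLaw (fun k x => β k * A x) P) (pathLaw (gibbsLaw fun x => β 0 * A x) P) :=
  ⟨A, β, q, P, monotone_β, q_pos, sum_q, P_zero_eq_imhKernel, P_one_eq_imhKernel, by
    rw [lhs_eq, rhs_eq]; norm_num⟩

end Summit.Ventures.LatticeQCDFlow.Theory2

end
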